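import Summits.Ventures.PercRepro.HallDisjointPairs

/-!
# PercRepro — HALL'S CONDITION FOR DISJOINTNESS ON A FAMILY OF PAIRS OF MINIMUM DEGREE `≥ 3` (the counting)
(p10, gen 5; `proofs/P10-HALLROW.md` §8; the lemma itself is `hall_disjoint_of_degree` in `HallDisjointDegreeHall`)

Let `𝒞` be a family of 2-sets in which every point of a member lies in at least `3` members — the edge set of a
graph of minimum degree `≥ 3`.  Then Hall's condition for the DISJOINTNESS relation holds on `𝒞`: every `𝒜 ⊆ 𝒞`
has at least `#𝒜` members of `𝒞` disjoint from some member of `𝒜`.  Nothing else is assumed: the single degree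
condition replaces the three hypotheses (G1)–(G3) of `hall_disjoint_pairs`, which fail on small configurations,
and it is exactly what the independent pairs of a rank-2 matroid of cogirth `≥ 3` satisfy (`RankTwoHall`).

Proof.  Write `V` for the points, `𝒜^⊥ = perp 𝒞 𝒜` (the members meeting every member of `𝒜`) and
`N(𝒜) = nbr 𝒞 𝒜`.  Double counting the incidences `(x, C)`, `x ∈ C` (`Finset.card_mul_le_card_mul`) gives from the
degree condition: (H1) every member has a disjoint member; (H2) the members avoiding a point `p ∈ V` number at
least `#V − 1 ≥ deg p` (and `#V ≥ 4`); (H3) `#𝒞 ≥ 6`.  Then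
* REDUCTION: `#𝒜 ≤ #N(𝒜)` follows from `#𝒜^⊥ ≤ #N(𝒜^⊥)`, since `𝒜` and `N(𝒜^⊥)` are disjoint subsets of `𝒞`
  and `#N(𝒜) + #𝒜^⊥ = #𝒞`;
* INTERSECTING `𝒜` (every two members meet): `𝒜` is a star through a point `p` — `N(𝒜)` contains every member
  avoiding `p`, except at most one when `#𝒜 = 2`, and (H1) / (H2) close — or `𝒜` contains a triangle, and then
  `𝒜` lies in the triangle while `N(𝒜)` contains everything outside it (H3);
* TWO DISJOINT MEMBERS `B₁, B₂ ∈ 𝒜`: `𝒜^⊥ ⊆ K := {{x, y} : x ∈ B₁, y ∈ B₂}`, and by the reduction it suffices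
  to prove Hall for `𝒜^⊥`: a sub-family of `K` is intersecting (done) or contains two opposite pairs `D₁, D₂`
  of `K`, and then `D₁, D₂ ∈ N`, the other two pairs of `K` are in `N` when both are present, and a single
  further member has a disjoint member by (H1).

* `pts` — the points of a family;  `card_mul_le_two_mul_card` — the double count;
* `deg_le_card_filter_disjoint_add` — at least `deg x − #S` members through `x` avoid `S`;
* `exists_disjoint_mem`, `card_pts_sub_one_le_card_filter`, `deg_add_one_le_card_pts`, `six_le_card` — (H1)–(H3);
* `card_le_card_nbr_of_perp` — the reduction;  `mem_nbr_of_disjoint`;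
* `hall_star`, `hall_triangle` — the star and the triangle case of an intersecting family.
-/

namespace PercRepro.HallDisjoint

open Finset

variable {α : Type} [DecidableEq α]

/-- The points of a family: the union of its members. -/
def pts (𝒞 : Finset (Finset α)) : Finset α := 𝒞.biUnion id

/-- Membership in `pts`. -/
theorem mem_pts {𝒞 : Finset (Finset α)} {x : α} : x ∈ pts 𝒞 ↔ ∃ C ∈ 𝒞, x ∈ C := by
  unfold pts
  rw [mem_biUnion]
  simp only [id_eq]

/-- A member lies in `pts`. -/
theorem subset_pts {𝒞 : Finset (Finset α)} {C : Finset α} (hC : C ∈ 𝒞) : C ⊆ pts 𝒞 :=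
  fun _ hx => mem_pts.2 ⟨C, hC, hx⟩

/-! ### The double count -/

/-- **Double count of the incidences**: if every point of `W` lies in at least `m` members of the family `𝒟`
of pairs, then `#W · m ≤ 2 · #𝒟`. -/
theorem card_mul_le_two_mul_card {𝒟 : Finset (Finset α)} (hpair : ∀ C ∈ 𝒟, C.card = 2) {W : Finset α}
    {m : ℕ} (hm : ∀ x ∈ W, m ≤ deg 𝒟 x) : W.card * m ≤ 𝒟.card * 2 := by
  apply card_mul_le_card_mul (fun x C => x ∈ C)
  · intro x hx
    have := hm x hx
    unfold deg at this
    simpa [bipartiteAbove] using this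
  · intro C hC
    calc (W.bipartiteBelow (fun x C => x ∈ C) C).card ≤ C.card := by
          apply card_le_card
          intro x hx
          exact ((mem_bipartiteBelow _).1 hx).2
      _ = 2 := hpair C hC

/-- The members through `x` meeting a set `S ∌ x` are among the pairs `{x, s}`, `s ∈ S`. -/
theorem card_filter_mem_not_disjoint_le {𝒞 : Finset (Finset α)} (hpair : ∀ C ∈ 𝒞, C.card = 2) {x : α}
    {S : Finset α} (hx : x ∉ S) :
    (𝒞.filter (fun C => x ∈ C ∧ ¬ Disjoint S C)).card ≤ S.card := by
  calc (𝒞.filter (fun C => x ∈ C ∧ ¬ Disjoint S C)).card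
      ≤ (S.image (fun s => ({x, s} : Finset α))).card := by
        apply card_le_card
        intro C hC
        rw [mem_filter] at hC
        obtain ⟨hC𝒞, hxC, hmeet⟩ := hC
        rw [not_disjoint_iff] at hmeet
        obtain ⟨s, hsS, hsC⟩ := hmeet
        rw [mem_image]
        refine ⟨s, hsS, ?_⟩
        have hxs : x ≠ s := fun h => hx (h ▸ hsS)
        exact (eq_pair_of_mem (hpair C hC𝒞) hxC hsC hxs).symm
    _ ≤ S.card := card_image_le

/-- At least `deg x − #S` members through `x ∉ S` avoid `S`. -/
theorem deg_le_card_filter_disjoint_add {𝒞 : Finset (Finset α)} (hpair : ∀ C ∈ 𝒞, C.card = 2) {x : α}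
    {S : Finset α} (hx : x ∉ S) :
    deg 𝒞 x ≤ (𝒞.filter (fun C => x ∈ C ∧ Disjoint S C)).card + S.card := by
  have h := card_filter_mem_not_disjoint_le hpair (𝒞 := 𝒞) hx
  have hsplit := card_filter_add_card_filter_not (s := 𝒞.filter (fun C => x ∈ C)) (fun C => Disjoint S C)
  rw [filter_filter, filter_filter] at hsplit
  unfold deg
  omega

/-! ### The three consequences of the degree condition -/

section Degree

variable {𝒞 : Finset (Finset α)} (hpair : ∀ C ∈ 𝒞, C.card = 2) (hdeg : ∀ C ∈ 𝒞, ∀ x ∈ C, 3 ≤ deg 𝒞 x)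
include hpair hdeg

omit hpair in
/-- A point of the family has degree `≥ 3`. -/
theorem three_le_deg_of_mem_pts {x : α} (hx : x ∈ pts 𝒞) : 3 ≤ deg 𝒞 x := by
  obtain ⟨C, hC, hxC⟩ := mem_pts.1 hx
  exact hdeg C hC x hxC

omit hdeg in
/-- `deg p + 1 ≤ #V` for a point `p ∈ V`: the members through `p` are the pairs `{p, y}`, `y ∈ V ∖ {p}`. -/
theorem deg_add_one_le_card_pts {p : α} (hp : p ∈ pts 𝒞) : deg 𝒞 p + 1 ≤ (pts 𝒞).card := by
  have h1 : deg 𝒞 p ≤ ((pts 𝒞).erase p).card := by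
    calc deg 𝒞 p = (𝒞.filter (fun C => p ∈ C)).card := rfl
      _ ≤ (((pts 𝒞).erase p).image (fun y => ({p, y} : Finset α))).card := by
          apply card_le_card
          intro C hC
          rw [mem_filter] at hC
          obtain ⟨y, hyC, hyp, hCeq⟩ := exists_other (hpair C hC.1) hC.2
          rw [mem_image]
          exact ⟨y, mem_erase.2 ⟨hyp, subset_pts hC.1 hyC⟩, hCeq.symm⟩
      _ ≤ ((pts 𝒞).erase p).card := card_image_le
  rw [card_erase_of_mem hp] at h1
  have := card_pos.2 ⟨p, hp⟩
  omega

/-- A nonempty family of minimum degree `≥ 3` has at least four points. -/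
theorem four_le_card_pts (hne : 𝒞.Nonempty) : 4 ≤ (pts 𝒞).card := by
  obtain ⟨C, hC⟩ := hne
  obtain ⟨a, b, _, hCeq⟩ := card_eq_two.1 (hpair C hC)
  have ha : a ∈ pts 𝒞 := subset_pts hC (by rw [hCeq]; exact mem_insert_self a {b})
  have h1 := deg_add_one_le_card_pts hpair ha
  have h2 := three_le_deg_of_mem_pts hdeg ha
  omega

/-- (H3) A nonempty family of minimum degree `≥ 3` has at least six members. -/
theorem six_le_card (hne : 𝒞.Nonempty) : 6 ≤ 𝒞.card := by
  have h1 := card_mul_le_two_mul_card hpair (W := pts 𝒞) (m := 3)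
    (fun x hx => three_le_deg_of_mem_pts hdeg hx)
  have h2 := four_le_card_pts hpair hdeg hne
  omega

/-- (H2) The members avoiding a point `p ∈ V` number at least `#V − 1`. -/
theorem card_pts_sub_one_le_card_filter {p : α} (hp : p ∈ pts 𝒞) :
    (pts 𝒞).card ≤ (𝒞.filter (fun C => p ∉ C)).card + 1 := by
  have hpair' : ∀ C ∈ 𝒞.filter (fun C => p ∉ C), C.card = 2 :=
    fun C hC => hpair C (mem_filter.1 hC).1
  have hm : ∀ x ∈ (pts 𝒞).erase p, 2 ≤ deg (𝒞.filter (fun C => p ∉ C)) x := by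
    intro x hx
    rw [mem_erase] at hx
    have h3 := three_le_deg_of_mem_pts hdeg hx.2
    have h := deg_le_card_filter_disjoint_add hpair (𝒞 := 𝒞) (S := {p}) (x := x)
      (by rw [mem_singleton]; exact hx.1)
    rw [card_singleton] at h
    unfold deg
    rw [filter_filter]
    have heq : 𝒞.filter (fun C => x ∈ C ∧ Disjoint {p} C) = 𝒞.filter (fun C => p ∉ C ∧ x ∈ C) := by
      apply filter_congr
      intro C _
      rw [disjoint_singleton_left, and_comm]
    rw [heq] at h
    omega
  have h1 := card_mul_le_two_mul_card hpair' hm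
  rw [card_erase_of_mem hp] at h1
  have := card_pos.2 ⟨p, hp⟩
  omega

/-- (H2′) The members avoiding a point `p ∈ V` number at least `deg p`. -/
theorem deg_le_card_filter_not_mem {p : α} (hp : p ∈ pts 𝒞) :
    deg 𝒞 p ≤ (𝒞.filter (fun C => p ∉ C)).card := by
  have h1 := deg_add_one_le_card_pts hpair hp
  have h2 := card_pts_sub_one_le_card_filter hpair hdeg hp
  omega

/-- (H2″) At least three members avoid any point `p ∈ V`. -/
theorem three_le_card_filter_not_mem {p : α} (hp : p ∈ pts 𝒞) :
    3 ≤ (𝒞.filter (fun C => p ∉ C)).card := by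
  have h1 := card_pts_sub_one_le_card_filter hpair hdeg hp
  have h2 := four_le_card_pts hpair hdeg ⟨_, (mem_pts.1 hp).choose_spec.1⟩
  omega

/-- (H1) Every member has a disjoint member. -/
theorem exists_disjoint_mem {C : Finset α} (hC : C ∈ 𝒞) : ∃ C' ∈ 𝒞, Disjoint C C' := by
  have h4 := four_le_card_pts hpair hdeg ⟨C, hC⟩
  have hlt : C.card < (pts 𝒞).card := by rw [hpair C hC]; omega
  obtain ⟨x, hx, hxC⟩ := exists_mem_notMem_of_card_lt_card hlt
  have h3 := three_le_deg_of_mem_pts hdeg hx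
  have h := deg_le_card_filter_disjoint_add hpair (𝒞 := 𝒞) (S := C) (x := x) hxC
  rw [hpair C hC] at h
  have hpos : 0 < (𝒞.filter (fun C' => x ∈ C' ∧ Disjoint C C')).card := by omega
  obtain ⟨C', hC'⟩ := card_pos.1 hpos
  rw [mem_filter] at hC'
  exact ⟨C', hC'.1, hC'.2.2⟩

end Degree

/-! ### The reduction to the perpendicular family -/

/-- **Reduction.** Hall's condition for `𝒜` follows from Hall's condition for `𝒜^⊥ = perp 𝒞 𝒜`: the families
`𝒜` and `nbr 𝒞 𝒜^⊥` are disjoint subsets of `𝒞`, and `#nbr 𝒞 𝒜 + #𝒜^⊥ = #𝒞`. -/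
theorem card_le_card_nbr_of_perp {𝒞 𝒜 : Finset (Finset α)} (h𝒜 : 𝒜 ⊆ 𝒞)
    (h : (perp 𝒞 𝒜).card ≤ (nbr 𝒞 (perp 𝒞 𝒜)).card) : 𝒜.card ≤ (nbr 𝒞 𝒜).card := by
  have hsplit := card_nbr_add_card_perp 𝒞 𝒜
  have hdisj : Disjoint 𝒜 (nbr 𝒞 (perp 𝒞 𝒜)) := by
    rw [disjoint_left]
    intro B hB hBn
    unfold nbr at hBn
    rw [mem_filter] at hBn
    obtain ⟨_, C, hC, hCB⟩ := hBn
    unfold perp at hC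
    rw [mem_filter] at hC
    exact hC.2 B hB hCB.symm
  have hsub : 𝒜 ∪ nbr 𝒞 (perp 𝒞 𝒜) ⊆ 𝒞 := union_subset h𝒜 (filter_subset _ _)
  have h1 := card_le_card hsub
  rw [card_union_of_disjoint hdisj] at h1
  omega

/-- A member of `𝒞` disjoint from a member of `𝒜` lies in `nbr 𝒞 𝒜`. -/
theorem mem_nbr_of_disjoint {𝒞 𝒜 : Finset (Finset α)} {C B : Finset α} (hC : C ∈ 𝒞) (hB : B ∈ 𝒜)
    (hd : Disjoint B C) : C ∈ nbr 𝒞 𝒜 := by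
  unfold nbr
  rw [mem_filter]
  exact ⟨hC, B, hB, hd⟩

/-! ### The intersecting case -/

section Intersecting

variable {𝒞 : Finset (Finset α)} (hpair : ∀ C ∈ 𝒞, C.card = 2) (hdeg : ∀ C ∈ 𝒞, ∀ x ∈ C, 3 ≤ deg 𝒞 x)
include hpair hdeg

/-- **The star case**: every member of the nonempty `𝒜 ⊆ 𝒞` contains `p`. -/
theorem hall_star {𝒜 : Finset (Finset α)} (h𝒜 : 𝒜 ⊆ 𝒞) {p : α} (hp : ∀ B ∈ 𝒜, p ∈ B)
    (hne : 𝒜.Nonempty) : 𝒜.card ≤ (nbr 𝒞 𝒜).card := by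
  obtain ⟨B₀, hB₀⟩ := hne
  have hpV : p ∈ pts 𝒞 := subset_pts (h𝒜 hB₀) (hp B₀ hB₀)
  rcases Nat.lt_or_ge 2 𝒜.card with h3 | h2
  · -- at least three members: every member avoiding `p` is a neighbour
    have hsub : 𝒞.filter (fun C => p ∉ C) ⊆ nbr 𝒞 𝒜 := by
      intro C hC
      rw [mem_filter] at hC
      by_contra hCn
      -- every member of `𝒜` meets `C`, hence is `{p, y}` with `y ∈ C`: `𝒜` injects into `C`
      have hAC : 𝒜 ⊆ C.image (fun y => ({p, y} : Finset α)) := by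
        intro B hB
        have hmeet : ¬ Disjoint B C := fun hd => hCn (mem_nbr_of_disjoint hC.1 hB hd)
        rw [not_disjoint_iff] at hmeet
        obtain ⟨y, hyB, hyC⟩ := hmeet
        have hyp : p ≠ y := fun h => hC.2 (h ▸ hyC)
        rw [mem_image]
        exact ⟨y, hyC, (eq_pair_of_mem (hpair B (h𝒜 hB)) (hp B hB) hyB hyp).symm⟩
      have := card_le_card hAC
      have := card_image_le (s := C) (f := fun y => ({p, y} : Finset α))
      have := hpair C hC.1
      omega
    have h1 := card_le_card hsub
    have h2 := deg_le_card_filter_not_mem hpair hdeg hpV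
    have h3 : 𝒜.card ≤ deg 𝒞 p := by
      unfold deg
      apply card_le_card
      intro B hB
      rw [mem_filter]
      exact ⟨h𝒜 hB, hp B hB⟩
    omega
  · rcases Nat.lt_or_ge 1 𝒜.card with h2' | h1
    · -- exactly two members `{p, a}`, `{p, b}`: every member avoiding `p` other than `{a, b}` is a neighbour
      obtain ⟨B₁, B₂, hB₁, hB₂, hB12⟩ := one_lt_card_iff.1 h2'
      obtain ⟨a, haB₁, hap, hB₁eq⟩ := exists_other (hpair B₁ (h𝒜 hB₁)) (hp B₁ hB₁)
      obtain ⟨b, hbB₂, hbp, hB₂eq⟩ := exists_other (hpair B₂ (h𝒜 hB₂)) (hp B₂ hB₂)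
      have hab : a ≠ b := by
        intro h
        apply hB12
        rw [hB₁eq, hB₂eq, h]
      have hsub : (𝒞.filter (fun C => p ∉ C)).erase {a, b} ⊆ nbr 𝒞 𝒜 := by
        intro C hC
        rw [mem_erase, mem_filter] at hC
        obtain ⟨hCab, hC𝒞, hpC⟩ := hC
        by_cases haC : a ∈ C
        · -- then `b ∉ C`, and `{p, b}` is disjoint from `C`
          have hbC : b ∉ C := fun hbC => hCab (eq_pair_of_mem (hpair C hC𝒞) haC hbC hab)
          apply mem_nbr_of_disjoint hC𝒞 hB₂
          rw [hB₂eq, disjoint_left]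
          intro x hx
          rw [mem_insert, mem_singleton] at hx
          rcases hx with rfl | rfl
          · exact hpC
          · exact hbC
        · apply mem_nbr_of_disjoint hC𝒞 hB₁
          rw [hB₁eq, disjoint_left]
          intro x hx
          rw [mem_insert, mem_singleton] at hx
          rcases hx with rfl | rfl
          · exact hpC
          · exact haC
      have h1 := card_le_card hsub
      have h2 := card_erase_le (s := 𝒞.filter (fun C => p ∉ C)) (a := ({a, b} : Finset α))
      have h3 := three_le_card_filter_not_mem hpair hdeg hpV
      have h4 := pred_card_le_card_erase (s := 𝒞.filter (fun C => p ∉ C)) (a := ({a, b} : Finset α))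
      omega
    · -- one member: it has a disjoint member by (H1)
      obtain ⟨C', hC', hd⟩ := exists_disjoint_mem hpair hdeg (h𝒜 hB₀)
      have h1 : 1 ≤ (nbr 𝒞 𝒜).card := card_pos.2 ⟨C', mem_nbr_of_disjoint hC' hB₀ hd⟩
      omega

/-- **The triangle case**: `𝒜 ⊆ 𝒞` is pairwise intersecting and contains the three sides of a triangle; then `𝒜`
lies in the triangle and every member of `𝒞` outside the triangle is a neighbour, while `#𝒞 ≥ 6`. -/
theorem hall_triangle {𝒜 : Finset (Finset α)} (h𝒜 : 𝒜 ⊆ 𝒞) {a b c : α} (hab : a ≠ b) (hbc : b ≠ c)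
    (hac : a ≠ c) (h0 : ({a, b} : Finset α) ∈ 𝒜) (h1 : ({b, c} : Finset α) ∈ 𝒜)
    (h2 : ({a, c} : Finset α) ∈ 𝒜) (hint : ∀ B₁ ∈ 𝒜, ∀ B₂ ∈ 𝒜, ¬ Disjoint B₁ B₂) :
    𝒜.card ≤ (nbr 𝒞 𝒜).card := by
  have hTcard : (({a, b, c} : Finset α).powersetCard 2).card = 3 := by
    rw [card_powersetCard]
    have h3 : ({a, b, c} : Finset α).card = 3 := by
      rw [card_insert_of_notMem, card_pair hbc]
      rw [mem_insert, mem_singleton]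
      rintro (h | h)
      · exact hab h
      · exact hac h
    rw [h3]
    rfl
  have hAT : 𝒜 ⊆ ({a, b, c} : Finset α).powersetCard 2 := by
    intro B hB
    rw [mem_powersetCard]
    exact ⟨subset_triple_of_meets (hpair B (h𝒜 hB)) hab hbc hac (hint _ h0 B hB) (hint _ h1 B hB)
      (hint _ h2 B hB), hpair B (h𝒜 hB)⟩
  have hsub : 𝒞 \ ({a, b, c} : Finset α).powersetCard 2 ⊆ nbr 𝒞 𝒜 := by
    intro C hC
    rw [mem_sdiff] at hC
    obtain ⟨hC𝒞, hCT⟩ := hC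
    by_contra hCn
    apply hCT
    rw [mem_powersetCard]
    refine ⟨subset_triple_of_meets (hpair C hC𝒞) hab hbc hac ?_ ?_ ?_, hpair C hC𝒞⟩
    · exact fun hd => hCn (mem_nbr_of_disjoint hC𝒞 h0 hd)
    · exact fun hd => hCn (mem_nbr_of_disjoint hC𝒞 h1 hd)
    · exact fun hd => hCn (mem_nbr_of_disjoint hC𝒞 h2 hd)
  have hA3 := card_le_card hAT
  have hN := card_le_card hsub
  have hsd := le_card_sdiff (({a, b, c} : Finset α).powersetCard 2) 𝒞
  have h6 := six_le_card hpair hdeg ⟨_, h𝒜 h0⟩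
  omega

end Intersecting

end PercRepro.HallDisjoint
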